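import Literature.Geometry.Riemannian.RicciHessianDivergence
import Literature.Geometry.Lorentzian.SurfaceTransgression
import Literature.Geometry.Lorentzian.CoordShrinkerIdentities
import Literature.Geometry.Lorentzian.CurvatureRegularity
import HarnessLib

/-!
# Hamilton's identities for gradient Ricci solitons on a manifold:
# `∇S = 2 Ric(∇f, ·)`, `d(S + |∇f|² − 2λf) = 0` and `ΔS − ⟨∇f, ∇S⟩ = 2λS − 2|Ric|²`

For a `C^∞` pseudo-Riemannian metric `g` with its Levi-Civita connection (`LeviCivita.lean`),
Ricci tensor `Ric = g.ricci`, scalar curvature `S = g.scalarCurvature`, Hessian `g.hessian`,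
gradient square `|∇f|² = g.gradSq f` and musical isomorphism `♯ = g.sharp`, and a `C^∞` function
`f` satisfying the **gradient Ricci soliton equation** `Ric + Hess f = λ g` (`λ ∈ ℝ`), we PROVE
at every point `x` and for every tangent vector `Y`:

* `mvfderiv_scalarCurvature_of_soliton` — **`dS_x(Y) = 2 Ric_x(♯df_x, Y)`**, i.e.
  `∇S = 2 Ric(∇f, ·)` (Munteanu–Wang 2016, §2 (p. 6), first displayed identity; Hamilton 1995,
  §20; Cao–Chen–Zhu 2008, Lemma 4.1);
* `mvfderiv_scalarCurvature_add_gradSq_of_soliton` — **`d(S + |∇f|² − 2λf)_x = 0`**, Hamilton's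
  conserved quantity (so that `S + |∇f|² − 2λf` is locally constant; with `λ = ½` this is the
  normalisation `S + |∇f|² = f` of Munteanu–Wang 2016, §2 and of
  `threeShrinkerClassification_modelData`, up to the additive constant of `f`);
* `dalembertian_scalarCurvature_of_soliton` — **`Δ_g S = g⁻¹(dS, df) + 2λS − 2|Ric|²_g`**, i.e.
  `Δ_f S = 2λS − 2|Ric|²` for the drift Laplacian `Δ_f = Δ − ∇f·∇` (Munteanu–Wang 2016, §2
  (p. 6), second displayed identity `Δ_f S = S − 2|Ric|²` for `λ = ½`; Eminenti–La Nave–Mantegazza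
  2008, Lemma 2.1; Petersen–Wylie 2009, Lemma 2.3), with its coordinate form
  `MetricCoord.IsMetricOn.lapAt_scalAt_of_soliton`: `ΔS = div ∇S = div(2 Ric(∇f, ·)♯)`
  (`∇S = 2Ric(∇f, ·)`), `div(Ric(∇f, ·)♯) = ½ dS(∇f) + tr_g(Ric ∘ ♯ ∘ Hess f)`
  (`RicciHessianDivergence.lean`, the contracted Bianchi identity once more), and
  `tr_g(Ric ∘ ♯ ∘ (λg − Ric)) = λS − |Ric|²`.

All are TRANSPORTED from the coordinate identities of `CoordShrinkerIdentities.lean`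
(`MetricCoord.IsMetricOn.fderiv_scalAt_of_soliton`, `fderiv_scalAt_add_gradSqAt_of_soliton`, which
rest on the contracted Bianchi identity `dS = 2 div Ric` and the Ricci identity for the Hessian)
through the chart at the point, exactly as the Bochner formula `dalembertian_gradSq_eq`
(`EigenvaluePinchingSphereProofs.lean`): the soliton equation is read in the chart
(`soliton_chartRep`: `ricci_comap_apply`, `hessian_comap_apply`, `OpensChart.ricci_eq_ricAt`,
`OpensChart.hessian_eq_hessAt`), the scalar curvature by `scalarCurvature_comap` /
`OpensChart.scalarCurvature_eq_scalAt` (`Lorentzian.scalarCurvature_chartInv_eq`, `SurfaceTransgression.lean`), differentials of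
functions by the chain rule (`mvfderiv_chartInv_apply_eq_fderiv`), and the gradient by
`mfderiv_chartInv_sharpAt_eq`. Everything is proved; no definition and no statement of `Prop` type
is introduced.

## References

* O. Munteanu, J. Wang, *Structure at infinity for shrinking Ricci solitons*, arXiv:1606.01861,
  §2 (p. 6). [MunteanuWang2016]
* R. S. Hamilton, *The formation of singularities in the Ricci flow*, Surveys in Differential
  Geometry 2 (1995) 7–136, §20. [Hamilton1995]
* H.-D. Cao, B.-L. Chen, X.-P. Zhu, *Recent developments on Hamilton's Ricci flow*, Surveys in
  Differential Geometry XII (2008), Lemma 4.1. [CaoChenZhu2007]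
* B. O'Neill, *Semi-Riemannian geometry with applications to relativity*, Academic Press 1983,
  Ch. 3, Cor. 3.54 and Prop. 3.59. [ONeill1983]
-/

noncomputable section

set_option maxSynthPendingDepth 3

open Bundle Set Function Filter
open scoped Manifold ContDiff Topology


/-! ### The coordinate identity `ΔS = dS(∇f) + 2λS − 2|Ric|²` -/

namespace Literature.Geometry.Lorentzian.MetricCoord

variable {E : Type*} [NormedAddCommGroup E] [NormedSpace ℝ E] [FiniteDimensional ℝ E]
  [CompleteSpace E] {G : E → E →L[ℝ] E →L[ℝ] ℝ} {V : Set E} {x : E} {f : E → ℝ} {lam : ℝ}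

omit [CompleteSpace E] in
/-- `tr_G (Ric ∘ ♯ ∘ Ric) = |Ric|²_G` for the (symmetric) Ricci form. [cite: ONeill1983, Ch. 3, pp. 60–61] -/
theorem IsMetricOn.mtrAt_ricAt_comp_sharpAt_comp_ricAt (hG : IsMetricOn G V) (hx : x ∈ V) :
    mtrAt G x ((ricAt G x).comp ((sharpAt G x).comp (ricAt G x))) = normSqAt G x (ricAt G x) := by
  have hflip : (ricAt G x).flip = ricAt G x := by
    ext v w
    exact hG.ricAt_comm hx w v
  rw [normSqAt, hflip, mtrAt]
  rfl

/-- **`ΔS = dS(∇f) + 2λS − 2|Ric|²` on a gradient Ricci soliton, in coordinates** (Munteanu–Wang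
2016, §2 (p. 6): `Δ_f S = S − 2|Ric|²` for `λ = ½`; Eminenti–La Nave–Mantegazza 2008, Lemma 2.1).
For metric components with `Ric + Hess f = λG` on `V`: `ΔS = div ∇S` (`divAt_gradAt`), and
`∇S = 2 Ric(∇f, ·)♯` near `x` (`fderiv_scalAt_of_soliton`), whose divergence is
`dS(∇f) + 2 tr_G(Ric ∘ ♯ ∘ Hess f)` (`divAt_sharpAt_ricAt_gradAt`); finally
`tr_G(Ric ∘ ♯ ∘ Hess f) = tr_G(Ric ∘ ♯ ∘ (λG − Ric)) = λS − |Ric|²`.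
[cite: MunteanuWang2016, §2 (p. 6)] [cite: Hamilton1995, §20] [cite: ONeill1983, Ch. 3, Cor. 3.54] -/
theorem IsMetricOn.lapAt_scalAt_of_soliton (hG : IsMetricOn G V) (hx : x ∈ V)
    (hf : ContDiffOn ℝ ∞ f V)
    (hsol : ∀ y ∈ V, ∀ v w, ricAt G y v w + hessAt G f y v w = lam * G y v w) :
    lapAt G (scalAt G) x =
      fderiv ℝ (scalAt G) x (sharpAt G x (fderiv ℝ f x)) + 2 * lam * scalAt G x
        - 2 * normSqAt G x (ricAt G x) := by
  have hi := hG.isInvertible x hx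
  -- regularity
  have hSx : ContDiffAt ℝ ∞ (scalAt G) x := hG.contDiffAt_scalAt hx
  have hdS : DifferentiableAt ℝ (fderiv ℝ (scalAt G)) x :=
    (hSx.fderiv_right (m := ∞) (by simp)).differentiableAt (by simp)
  have hfx : ContDiffAt ℝ ∞ f x := hf.contDiffAt (hG.mem_nhds hx)
  have hdf : DifferentiableAt ℝ (fderiv ℝ f) x :=
    (hfx.fderiv_right (m := ∞) (by simp)).differentiableAt (by simp)
  set Z : E → E := fun y ↦ sharpAt G y (ricAt G y (sharpAt G y (fderiv ℝ f y))) with hZdef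
  have hZd : DifferentiableAt ℝ Z x :=
    (hG.differentiableAt_sharpAt hx).clm_apply ((hG.differentiableAt_ricAt hx).clm_apply
      ((hG.differentiableAt_sharpAt hx).clm_apply hdf))
  -- (1) `ΔS = div ∇S`
  rw [← hG.divAt_gradAt hx hdS]
  -- (2) `∇S = 2 Z` near `x`
  have hfield : (fun y ↦ sharpAt G y (fderiv ℝ (scalAt G) y)) =ᶠ[𝓝 x] fun y ↦ (2 : ℝ) • Z y := by
    filter_upwards [hG.mem_nhds hx] with y hy
    have hd : fderiv ℝ (scalAt G) y = (2 : ℝ) • ricAt G y (sharpAt G y (fderiv ℝ f y)) := by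
      ext Y
      rw [hG.fderiv_scalAt_of_soliton hy hf hsol Y]
      rfl
    simp only [hZdef, hd, map_smul]
  rw [divAt_congr_of_eventuallyEq hfield]
  -- (3) `div (2 Z) = 2 div Z = dS(∇f) + 2 tr(Ric ∘ ♯ ∘ Hess f)`
  have h2 : divAt G (fun y ↦ (2 : ℝ) • Z y) x = 2 * divAt G Z x := by
    have h := divAt_smul (G := G) (Z := Z) (ψ := fun _ ↦ (2 : ℝ)) (differentiableAt_const _) hZd
    simpa [fderiv_const] using h
  rw [h2, hZdef, hG.divAt_sharpAt_ricAt_gradAt hx hdf]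
  -- (4) `tr(Ric ∘ ♯ ∘ Hess f) = λ S − |Ric|²`
  have hH : hessAt G f x = lam • G x - ricAt G x := by
    ext v w
    have h := hsol x hx v w
    simp only [FunLike.coe_sub, Pi.sub_apply, FunLike.coe_smul, Pi.smul_apply, smul_eq_mul]
    linarith
  have hid : (sharpAt G x).comp (G x) = ContinuousLinearMap.id ℝ E := by
    ext v
    simp [sharpAt_apply hi]
  have htr : mtrAt G x ((ricAt G x).comp ((sharpAt G x).comp (hessAt G f x))) =
      lam * scalAt G x - normSqAt G x (ricAt G x) := by
    rw [hH, ContinuousLinearMap.comp_sub, ContinuousLinearMap.comp_smul, hid,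
      ContinuousLinearMap.comp_sub, ContinuousLinearMap.comp_smul, ContinuousLinearMap.comp_id,
      mtrAt_sub, mtrAt_smul, hG.mtrAt_ricAt_comp_sharpAt_comp_ricAt hx]
    rfl
  rw [htr]
  ring

/-- The same with `dS(∇f) = 2 Ric(∇f, ∇f)` substituted:
`ΔS = 2 Ric(♯Df, ♯Df) + 2λS − 2|Ric|²`. [cite: MunteanuWang2016, §2 (p. 6)] -/
theorem IsMetricOn.lapAt_scalAt_of_soliton' (hG : IsMetricOn G V) (hx : x ∈ V)
    (hf : ContDiffOn ℝ ∞ f V)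
    (hsol : ∀ y ∈ V, ∀ v w, ricAt G y v w + hessAt G f y v w = lam * G y v w) :
    lapAt G (scalAt G) x =
      2 * ricAt G x (sharpAt G x (fderiv ℝ f x)) (sharpAt G x (fderiv ℝ f x))
        + 2 * lam * scalAt G x - 2 * normSqAt G x (ricAt G x) := by
  rw [hG.lapAt_scalAt_of_soliton hx hf hsol, hG.fderiv_scalAt_of_soliton hx hf hsol]

end Literature.Geometry.Lorentzian.MetricCoord

namespace Literature.Geometry.Riemannian

open Lorentzian Lorentzian.PseudoRiemannianMetric

section Pointwise

variable {E : Type*} [NormedAddCommGroup E] [NormedSpace ℝ E] [FiniteDimensional ℝ E]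
  {H : Type*} [TopologicalSpace H] {I : ModelWithCorners ℝ E H} [I.Boundaryless]
  {M : Type*} [TopologicalSpace M] [ChartedSpace H M] [IsManifold I ∞ M]
  (g : PseudoRiemannianMetric I ∞ E (TangentSpace I : M → Type _)) [g.HasLeviCivita]

/-! ### Reading the data in the chart -/

omit [FiniteDimensional ℝ E] [g.HasLeviCivita] in
/-- **Differentials read in the chart**: `dF_{Φ u}(dΦ_u Y) = D(F ∘ φ⁻¹)(u) Y` (the chain rule and
`OpensChart.mvfderiv_eq`, `mvfderiv_comp_chartInv_toLinearMap`). [folklore] -/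
theorem mvfderiv_chartInv_apply_eq_fderiv (x₀ : M) (u : chartTarget I x₀) {F : M → ℝ}
    (hF : MDifferentiableAt I 𝓘(ℝ, ℝ) F (chartInv I x₀ u)) (Y : E) :
    mvfderiv I F (chartInv I x₀ u) (mfderiv 𝓘(ℝ, E) I (chartInv I x₀) u Y) =
      fderiv ℝ (F ∘ (extChartAt I x₀).symm) u Y := by
  have hΦu : MDifferentiableAt 𝓘(ℝ, E) I (chartInv I x₀) u :=
    ((contMDiff_chartInv x₀).of_le le_add_self u).mdifferentiableAt one_ne_zero
  rw [← mvfderiv_comp_apply hF hΦu Y]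
  exact LinearMap.congr_fun (mvfderiv_comp_chartInv_toLinearMap x₀ u hF) Y

/-- **The soliton equation read in the chart**: if `Ric + Hess f = λ g` at `Φ u` (on all pairs of
tangent vectors), then the chart components satisfy `ricAt G u + hessAt G f̂ u = λ G u`,
`f̂ = f ∘ φ⁻¹` (`ricci_comap_apply`, `hessian_comap_apply`, `OpensChart.ricci_eq_ricAt`,
`OpensChart.hessian_eq_hessAt`). [cite: ONeill1983, Ch. 3, Prop. 3.59] -/
theorem soliton_chartRep (x₀ : M) (u : chartTarget I x₀) {f : M → ℝ} {lam : ℝ}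
    (hf : ContMDiffAt I 𝓘(ℝ, ℝ) 2 f (chartInv I x₀ u))
    (hsol : ∀ X Y : TangentSpace I (chartInv I x₀ u),
      g.ricci (chartInv I x₀ u) X Y + g.hessian f (chartInv I x₀ u) X Y =
        lam * g.val (chartInv I x₀ u) X Y)
    (v w : E) :
    MetricCoord.ricAt (chartRep I (fun _ ↦ g) x₀ 0) u v w
        + MetricCoord.hessAt (chartRep I (fun _ ↦ g) x₀ 0) (f ∘ (extChartAt I x₀).symm) u v w =
      lam * chartRep I (fun _ ↦ g) x₀ 0 u v w := by
  haveI := (chartPullback I g x₀).hasLeviCivita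
  have hG := val_chartPullback_eq_chartRep (fun _ : ℝ ↦ g) x₀ 0
  have hrep : ContDiffAt ℝ 2 (f ∘ (extChartAt I x₀).symm) (u : E) := by
    have hsymm : ContMDiffAt 𝓘(ℝ, E) I 2 (extChartAt I x₀).symm (u : E) :=
      (contMDiffOn_extChartAt_symm x₀).contMDiffAt
        ((isOpen_extChartAt_target x₀).mem_nhds u.2)
    exact contMDiffAt_iff_contDiffAt.1 (hf.comp (u : E) hsymm)
  have h := hsol (mfderiv 𝓘(ℝ, E) I (chartInv I x₀) u v) (mfderiv 𝓘(ℝ, E) I (chartInv I x₀) u w)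
  rw [← Lorentzian.OpensChart.ricci_eq_ricAt hG u,
    ← Lorentzian.OpensChart.hessian_eq_hessAt hG u (f := f ∘ chartInv I x₀) (fun _ ↦ rfl) hrep,
    g.ricci_comap_apply contMDiff_pullbackBilin_holds (contMDiff_chartInv x₀)
      (injective_mfderiv_chartInv x₀) rfl u,
    g.hessian_comap_apply contMDiff_pullbackBilin_holds (contMDiff_chartInv x₀)
      (injective_mfderiv_chartInv x₀) rfl hf, chartRep_apply, val_chartPullback_apply]
  exact h

/-- The soliton equation on the whole chart target, for `f` smooth and the soliton equation
holding everywhere. [cite: ONeill1983, Ch. 3, Prop. 3.59] -/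
theorem soliton_chartRep_target (x₀ : M) {f : M → ℝ} {lam : ℝ} (hf : ContMDiff I 𝓘(ℝ, ℝ) ∞ f)
    (hsol : ∀ (x : M) (X Y : TangentSpace I x),
      g.ricci x X Y + g.hessian f x X Y = lam * g.val x X Y) :
    ∀ y ∈ (extChartAt I x₀).target, ∀ v w : E,
      MetricCoord.ricAt (chartRep I (fun _ ↦ g) x₀ 0) y v w
          + MetricCoord.hessAt (chartRep I (fun _ ↦ g) x₀ 0) (f ∘ (extChartAt I x₀).symm) y v w =
        lam * chartRep I (fun _ ↦ g) x₀ 0 y v w := by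
  intro y hy v w
  have hf2 : ContMDiffAt I 𝓘(ℝ, ℝ) 2 f (chartInv I x₀ ⟨y, hy⟩) :=
    (hf.of_le (WithTop.coe_le_coe.mpr le_top)).contMDiffAt
  exact soliton_chartRep g x₀ ⟨y, hy⟩ hf2 (hsol _) v w

/-! ### `∇S = 2 Ric(∇f, ·)` -/

/-- **Hamilton's identity `∇S = 2 Ric(∇f, ·)` on a gradient Ricci soliton** (Munteanu–Wang 2016,
§2 (p. 6): "`∇S = 2Ric(∇f)`"; Hamilton 1995, §20; Cao–Chen–Zhu 2008, Lemma 4.1). For a `C^∞`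
metric `g` and a `C^∞` function `f` with `Ric + Hess f = λ g` everywhere, at every point `x` and
for every `Y ∈ T_x M`: `dS_x(Y) = 2 Ric_x(♯ df_x, Y)`. Proof: the coordinate identity
`IsMetricOn.fderiv_scalAt_of_soliton` (contracted Bianchi identity, divergence of the Hessian,
traced soliton equation) in the chart at `x`, read back through the chart.
[cite: MunteanuWang2016, §2 (p. 6)] [cite: Hamilton1995, §20] [cite: CaoChenZhu2007, Lemma 4.1] -/
theorem mvfderiv_scalarCurvature_of_soliton {f : M → ℝ} (hf : ContMDiff I 𝓘(ℝ, ℝ) ∞ f)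
    {lam : ℝ}
    (hsol : ∀ (x : M) (X Y : TangentSpace I x),
      g.ricci x X Y + g.hessian f x X Y = lam * g.val x X Y)
    (x : M) (Y : TangentSpace I x) :
    mvfderiv I g.scalarCurvature x Y =
      2 * g.ricci x (g.sharp x (mvfderiv I f x : TangentSpace I x →ₗ[ℝ] ℝ)) Y := by
  -- the chart at `x`, components and representatives
  set G := chartRep I (fun _ ↦ g) x 0 with hGdef
  have hGm : MetricCoord.IsMetricOn G (extChartAt I x).target :=
    Lorentzian.OpensChart.isMetricOn_repr (val_chartPullback_eq_chartRep (fun _ : ℝ ↦ g) x 0)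
  set fh : E → ℝ := f ∘ (extChartAt I x).symm with hfhdef
  have hu0 : extChartAt I x x ∈ (extChartAt I x).target := mem_extChartAt_target x
  set u₀ : chartTarget I x := ⟨extChartAt I x x, hu0⟩ with hu₀def
  have hΦu₀ : chartInv I x u₀ = x := extChartAt_to_inv x
  have hfh : ContDiffOn ℝ ∞ fh (extChartAt I x).target := by
    rw [hfhdef, ← contMDiffOn_iff_contDiffOn]
    exact hf.comp_contMDiffOn (contMDiffOn_extChartAt_symm x)
  have hsolc := soliton_chartRep_target g x hf hsol
  -- the coordinate identity at `φ x`
  have key := hGm.fderiv_scalAt_of_soliton hu0 hfh hsolc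
  -- it suffices to prove the statement at `Φ u₀ = x`
  suffices h : ∀ Y' : TangentSpace I (chartInv I x u₀),
      mvfderiv I g.scalarCurvature (chartInv I x u₀) Y' =
        2 * g.ricci (chartInv I x u₀) (g.sharp (chartInv I x u₀)
          (mvfderiv I f (chartInv I x u₀) : TangentSpace I (chartInv I x u₀) →ₗ[ℝ] ℝ)) Y' by
    rw [hΦu₀] at h
    exact h Y
  intro Y'
  -- `Y' = dΦ Yc`
  have hinv := isInvertible_mfderiv_of_injective rfl (injective_mfderiv_chartInv x u₀)
  obtain ⟨Yc, rfl⟩ : ∃ Yc : E, mfderiv 𝓘(ℝ, E) I (chartInv I x) u₀ Yc = Y' :=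
    ⟨(mfderiv 𝓘(ℝ, E) I (chartInv I x) u₀).inverse Y', by
      rw [← ContinuousLinearMap.comp_apply, hinv.self_comp_inverse]; rfl⟩
  -- left-hand side: `dS(dΦ Yc) = ∂_{Yc} scalAt G`
  have hSd : MDifferentiableAt I 𝓘(ℝ, ℝ) g.scalarCurvature (chartInv I x u₀) :=
    (contMDiff_scalarCurvature g).mdifferentiableAt (by simp)
  have hSrep : (g.scalarCurvature ∘ (extChartAt I x).symm) =ᶠ[𝓝 (u₀ : E)]
      MetricCoord.scalAt G := by
    filter_upwards [(isOpen_extChartAt_target x).mem_nhds hu0] with z hz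
    exact Lorentzian.scalarCurvature_chartInv_eq g x ⟨z, hz⟩
  have hL : mvfderiv I g.scalarCurvature (chartInv I x u₀)
      (mfderiv 𝓘(ℝ, E) I (chartInv I x) u₀ Yc) = fderiv ℝ (MetricCoord.scalAt G) (u₀ : E) Yc := by
    rw [mvfderiv_chartInv_apply_eq_fderiv x u₀ hSd Yc, hSrep.fderiv_eq]
  -- right-hand side: `Ric(♯df, dΦ Yc) = ricAt G (♯_G Df̂) Yc`
  have hfd : MDifferentiableAt I 𝓘(ℝ, ℝ) f (chartInv I x u₀) := hf.mdifferentiableAt (by simp)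
  have hR : g.ricci (chartInv I x u₀) (g.sharp (chartInv I x u₀)
      (mvfderiv I f (chartInv I x u₀) : TangentSpace I (chartInv I x u₀) →ₗ[ℝ] ℝ))
      (mfderiv 𝓘(ℝ, E) I (chartInv I x) u₀ Yc) =
      MetricCoord.ricAt G u₀ (MetricCoord.sharpAt G u₀ (fderiv ℝ fh u₀)) Yc := by
    haveI := (chartPullback I g x).hasLeviCivita
    have hG := val_chartPullback_eq_chartRep (fun _ : ℝ ↦ g) x 0
    rw [← mfderiv_chartInv_sharpAt_eq g x u₀ hfd,
      ← g.ricci_comap_apply contMDiff_pullbackBilin_holds (contMDiff_chartInv x)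
        (injective_mfderiv_chartInv x) rfl u₀,
      Lorentzian.OpensChart.ricci_eq_ricAt hG u₀]
  rw [hL, hR]
  exact key Yc

/-! ### Hamilton's conserved quantity `S + |∇f|² − 2λf` -/

/-- **`d(S + |∇f|² − 2λ f) = 0` on a gradient Ricci soliton** (Hamilton 1995, §20;
Cao–Chen–Zhu 2008, (4.4); Munteanu–Wang 2016, §2 (p. 6): the soliton is normalised by
`S + |∇f|² = f` after adding a constant to `f`, `λ = ½`). For a `C^∞` metric `g` and a `C^∞`
function `f` with `Ric + Hess f = λ g` everywhere, the differential of
`y ↦ S(y) + |∇f|²(y) − 2λ f(y)` vanishes at every point; transported from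
`IsMetricOn.fderiv_scalAt_add_gradSqAt_of_soliton` (`gradSq_chartInv_eq` for `|∇f|²`).
[cite: MunteanuWang2016, §2 (p. 6)] [cite: Hamilton1995, §20] [cite: CaoChenZhu2007, Lemma 4.1] -/
theorem mvfderiv_scalarCurvature_add_gradSq_of_soliton {f : M → ℝ} (hf : ContMDiff I 𝓘(ℝ, ℝ) ∞ f)
    {lam : ℝ}
    (hsol : ∀ (x : M) (X Y : TangentSpace I x),
      g.ricci x X Y + g.hessian f x X Y = lam * g.val x X Y)
    (x : M) (Y : TangentSpace I x) :
    mvfderiv I (fun y ↦ g.scalarCurvature y + g.gradSq f y - 2 * lam * f y) x Y = 0 := by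
  set G := chartRep I (fun _ ↦ g) x 0 with hGdef
  have hGm : MetricCoord.IsMetricOn G (extChartAt I x).target :=
    Lorentzian.OpensChart.isMetricOn_repr (val_chartPullback_eq_chartRep (fun _ : ℝ ↦ g) x 0)
  set fh : E → ℝ := f ∘ (extChartAt I x).symm with hfhdef
  have hu0 : extChartAt I x x ∈ (extChartAt I x).target := mem_extChartAt_target x
  set u₀ : chartTarget I x := ⟨extChartAt I x x, hu0⟩ with hu₀def
  have hΦu₀ : chartInv I x u₀ = x := extChartAt_to_inv x
  have hfh : ContDiffOn ℝ ∞ fh (extChartAt I x).target := by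
    rw [hfhdef, ← contMDiffOn_iff_contDiffOn]
    exact hf.comp_contMDiffOn (contMDiffOn_extChartAt_symm x)
  have hsolc := soliton_chartRep_target g x hf hsol
  have key := hGm.fderiv_scalAt_add_gradSqAt_of_soliton hu0 hfh hsolc
  -- the function and its smoothness
  set F : M → ℝ := fun y ↦ g.scalarCurvature y + g.gradSq f y - 2 * lam * f y with hFdef
  have hFs : ContMDiff I 𝓘(ℝ, ℝ) ∞ F :=
    ((contMDiff_scalarCurvature g).add (contMDiff_gradSq g hf)).sub (contMDiff_const.mul hf)
  suffices h : ∀ Y' : TangentSpace I (chartInv I x u₀), mvfderiv I F (chartInv I x u₀) Y' = 0 by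
    rw [hΦu₀] at h
    exact h Y
  intro Y'
  have hinv := isInvertible_mfderiv_of_injective rfl (injective_mfderiv_chartInv x u₀)
  obtain ⟨Yc, rfl⟩ : ∃ Yc : E, mfderiv 𝓘(ℝ, E) I (chartInv I x) u₀ Yc = Y' :=
    ⟨(mfderiv 𝓘(ℝ, E) I (chartInv I x) u₀).inverse Y', by
      rw [← ContinuousLinearMap.comp_apply, hinv.self_comp_inverse]; rfl⟩
  have hFd : MDifferentiableAt I 𝓘(ℝ, ℝ) F (chartInv I x u₀) := hFs.mdifferentiableAt (by simp)
  -- the representative of `F` near `φ x`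
  have hFrep : (F ∘ (extChartAt I x).symm) =ᶠ[𝓝 (u₀ : E)]
      fun y ↦ MetricCoord.scalAt G y + MetricCoord.gradSqAt G fh y - 2 * lam * fh y := by
    filter_upwards [(isOpen_extChartAt_target x).mem_nhds hu0] with z hz
    have h1 := Lorentzian.scalarCurvature_chartInv_eq g x ⟨z, hz⟩
    have h2 := gradSq_chartInv_eq g x ⟨z, hz⟩ (F := f) (hf.mdifferentiableAt (by simp))
    simp only [hFdef, Function.comp_apply]
    rw [show (extChartAt I x).symm z = chartInv I x ⟨z, hz⟩ from rfl, h1, h2]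
    rfl
  rw [mvfderiv_chartInv_apply_eq_fderiv x u₀ hFd Yc, hFrep.fderiv_eq]
  exact key Yc


/-! ### `Δ_f S = 2λS − 2|Ric|²` -/

/-- **`Δ_g S = g⁻¹(dS, df) + 2λS − 2|Ric|²_g` on a gradient Ricci soliton**, i.e.
`Δ_f S = 2λS − 2|Ric|²` for `Δ_f = Δ − ⟨∇f, ∇·⟩` (Munteanu–Wang 2016, §2 (p. 6):
"`Δ_f S = S − 2|Ric|²`", `λ = ½`; Eminenti–La Nave–Mantegazza 2008, Lemma 2.1; Petersen–Wylie
2009, Lemma 2.3). Here `Δ_g = tr_g Hess` (`dalembertian`), `g⁻¹(dS, df)` is `innerDual` of the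
two differentials and `|Ric|²_g = g.normSq (g.ricci)`. Transported from
`IsMetricOn.lapAt_scalAt_of_soliton` through the chart at `x` (`dalembertian_chartInv_eq`,
`innerDual_chartInv_eq`, `normSq_chartPullback_eq` with `ricci_comap_apply`,
`OpensChart.normSq_ricci_eq_normSqAt`). [cite: MunteanuWang2016, §2 (p. 6)]
[cite: Hamilton1995, §20] -/
theorem dalembertian_scalarCurvature_of_soliton {f : M → ℝ} (hf : ContMDiff I 𝓘(ℝ, ℝ) ∞ f)
    {lam : ℝ}
    (hsol : ∀ (x : M) (X Y : TangentSpace I x),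
      g.ricci x X Y + g.hessian f x X Y = lam * g.val x X Y) (x : M) :
    g.dalembertian g.scalarCurvature x =
      g.innerDual x (mvfderiv I g.scalarCurvature x : TangentSpace I x →ₗ[ℝ] ℝ)
          (mvfderiv I f x : TangentSpace I x →ₗ[ℝ] ℝ)
        + 2 * lam * g.scalarCurvature x - 2 * g.normSq x (g.ricci x) := by
  set G := chartRep I (fun _ ↦ g) x 0 with hGdef
  have hGm : MetricCoord.IsMetricOn G (extChartAt I x).target :=
    Lorentzian.OpensChart.isMetricOn_repr (val_chartPullback_eq_chartRep (fun _ : ℝ ↦ g) x 0)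
  set fh : E → ℝ := f ∘ (extChartAt I x).symm with hfhdef
  have hu0 : extChartAt I x x ∈ (extChartAt I x).target := mem_extChartAt_target x
  set u₀ : chartTarget I x := ⟨extChartAt I x x, hu0⟩ with hu₀def
  have hΦu₀ : chartInv I x u₀ = x := extChartAt_to_inv x
  have hfh : ContDiffOn ℝ ∞ fh (extChartAt I x).target := by
    rw [hfhdef, ← contMDiffOn_iff_contDiffOn]
    exact hf.comp_contMDiffOn (contMDiffOn_extChartAt_symm x)
  have hsolc := soliton_chartRep_target g x hf hsol
  have key := hGm.lapAt_scalAt_of_soliton hu0 hfh hsolc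
  -- regularity on the manifold
  have hS : ContMDiff I 𝓘(ℝ, ℝ) ∞ g.scalarCurvature := contMDiff_scalarCurvature g
  have hS2 : ContMDiffAt I 𝓘(ℝ, ℝ) 2 g.scalarCurvature (chartInv I x u₀) :=
    (hS.of_le (WithTop.coe_le_coe.mpr le_top)).contMDiffAt
  have hSd : MDifferentiableAt I 𝓘(ℝ, ℝ) g.scalarCurvature (chartInv I x u₀) :=
    hS.mdifferentiableAt (by simp)
  have hfd : MDifferentiableAt I 𝓘(ℝ, ℝ) f (chartInv I x u₀) := hf.mdifferentiableAt (by simp)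
  have hSrep : (g.scalarCurvature ∘ (extChartAt I x).symm) =ᶠ[𝓝 (u₀ : E)]
      MetricCoord.scalAt G := by
    filter_upwards [(isOpen_extChartAt_target x).mem_nhds hu0] with z hz
    exact Lorentzian.scalarCurvature_chartInv_eq g x ⟨z, hz⟩
  -- (a) `ΔS`
  have hlap : g.dalembertian g.scalarCurvature x =
      MetricCoord.lapAt G (MetricCoord.scalAt G) (extChartAt I x x) := by
    have h := dalembertian_chartInv_eq g x u₀ hS2
    rw [hΦu₀] at h
    rw [h]
    exact MetricCoord.lapAt_congr_of_eventuallyEq G hSrep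
  -- (b) `g⁻¹(dS, df)`
  have hI : g.innerDual x (mvfderiv I g.scalarCurvature x : TangentSpace I x →ₗ[ℝ] ℝ)
      (mvfderiv I f x : TangentSpace I x →ₗ[ℝ] ℝ) =
      fderiv ℝ (MetricCoord.scalAt G) (extChartAt I x x)
        (MetricCoord.sharpAt G (extChartAt I x x) (fderiv ℝ fh (extChartAt I x x))) := by
    have h := innerDual_chartInv_eq g x u₀ hSd hfd
    rw [hΦu₀] at h
    rw [h, hSrep.fderiv_eq]
  -- (c) `S`
  have hSx : g.scalarCurvature x = MetricCoord.scalAt G (extChartAt I x x) := by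
    have h := Lorentzian.scalarCurvature_chartInv_eq g x u₀
    rw [hΦu₀] at h
    exact h
  -- (d) `|Ric|²`
  have hN : g.normSq x (g.ricci x) =
      MetricCoord.normSqAt G (extChartAt I x x) (MetricCoord.ricAt G (extChartAt I x x)) := by
    haveI := (chartPullback I g x).hasLeviCivita
    have hG := val_chartPullback_eq_chartRep (fun _ : ℝ ↦ g) x 0
    have h1 : (chartPullback I g x).normSq u₀ ((chartPullback I g x).ricci u₀) =
        g.normSq (chartInv I x u₀) (g.ricci (chartInv I x u₀)) :=
      normSq_chartPullback_eq g x u₀ _ _ (fun v w ↦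
        g.ricci_comap_apply contMDiff_pullbackBilin_holds (contMDiff_chartInv x)
          (injective_mfderiv_chartInv x) rfl u₀ v w)
    rw [hΦu₀] at h1
    rw [← h1]
    exact Lorentzian.OpensChart.normSq_ricci_eq_normSqAt hG u₀
  rw [hlap, hI, hSx, hN]
  exact key

end Pointwise

end Literature.Geometry.Riemannian

end
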